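import Mathlib.NumberTheory.LSeries.Dirichlet
import Mathlib.NumberTheory.LSeries.Injectivity
import Mathlib.NumberTheory.LSeries.Convolution
import Literature.NumberTheory.Sieve.BombieriAsymptoticSieveMertens
import Literature.NumberTheory.Sieve.ParityBarrierProofs
import Literature.NumberTheory.Sieve.BombieriAsymptoticSieve
import HarnessLib

/-!
# Bombieri's asymptotic sieve: Lemmata 6–9 of Friedlander–Iwaniec for `K = ℚ`, proved

Topic `Literature/NumberTheory/Sieve`, companion ("Proofs") file of `BombieriAsymptoticSieve.lean`.
Source: J. Friedlander, H. Iwaniec, *On Bombieri's asymptotic sieve*, Ann. Scuola Norm. Sup. Pisa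
Cl. Sci. (4) **5** (1978) 719–756 [FriedlanderIwaniecPisa1978], §4, Lemmata 6–9 (pp. 735–737),
specialised to `K = ℚ`, `N = 1` (`b = b₁ = b₂ = 1`, `f̃ = f`, `ζ_K = ζ`; the subscript printed as
`b_z` in Lemmata 6 and 9 is `b₂`), for a sequence satisfying Bombieri's (A₁), (A₅)
(`SieveSequence.BombieriA1`, `BombieriA5` of `BombieriAsymptoticSieve.lean`). Everything here is a
THEOREM (no named facts): these are the consumers of the analytic hypothesis (A₅) in the proof of
Bombieri's Theorem 1, and the inputs of Lemmata 11–12 there.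

* `FI1978_lemma6_rat` — Lemma 6: the Dirichlet coefficients `b` of `G(s) = ∑ b(δ) δ^{−s}` in
  (A₅) `∑ g(d) d^{−s} = ζ(s+1) G(s)` are real... more precisely their real parts `b` satisfy
  `b(1) = 1`, `g(n) = ∑_{δ ∣ n} b(δ) (n/δ)⁻¹` (uniqueness of Dirichlet coefficients, Mathlib's
  `LSeries.eq_of_LSeries_eventually_eq` with `LSeries_convolution'`), and `∑_δ |b(δ)| δ^{η} < ∞`
  for `η = η₁/2` (so `∑_{δ ≥ z} |b(δ)| ≪ z^{−η}`, FI's `∑_{δ ≥ z} |g_δ| δ⁻¹ ≪ z^{−η}` with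
  `g_δ = δ b(δ)`);
* `FI1978_lemma7_rat` — Lemma 7: `H = ∏_p (1 − g(p))(1 − 1/p)⁻¹` converges, `H > 0`
  (`A.HasDensityConstant H`), `∏_{p<z}(1 − g(p)) = H ∏_{p<z}(1 − 1/p)(1 + O(z^{−η})) ≪ 1/log z`;
* `FI1978_lemma8_rat` — Lemma 8 (with absolute values, since Bombieri's (A₁) has no `f > 0`):
  `∑_{d ≤ x, (d, P(z)) = 1} |g(d)| ≪ log x / log z` for `2 ≤ z ≤ x`;
* `FI1978_lemma9_rat` — Lemma 9: `∑_{d ≤ x, (d, P(z)) = 1} |g(d) V(z) − H P(z)/d| ≪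
  z^{−η} log x / log z`, `V(z) = ∏_{p<z}(1 − g(p))`, `P(z) = ∏_{p<z}(1 − 1/p)`.

The elementary inputs (Mertens quotients, sums over rough numbers, tails) are in
`BombieriAsymptoticSieveMertens.lean`; the divisor-sum swap uses
`sum_Ioc_mul_apply_mul_eq_sum_sum` of `ParityBarrierProofs.lean`.
-/

noncomputable section

open Filter Asymptotics Finset
open scoped Topology

namespace Literature.NumberTheory.Sieve

namespace BombieriSieve

/-! ### Lemma 6 for `K = ℚ`: the coefficients of `G` -/

/-- **[FriedlanderIwaniecPisa1978] Lemma 6 for `K = ℚ`, `N = 1`** ("Let `g_δ` be defined by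
`1/f̃(m) = m⁻¹ ∑_{δd = m} b₂(d) g_δ`. Then, for `z ≥ 1`, `∑_{δ ≥ z} |g_δ| δ⁻¹ ≪ z^{−η}`"; here
`b₂ = 1`, `f̃ = f`, so `g_δ = δ b(δ)` with `G(s) = ∑ b(δ) δ^{−s}` from (A₅)), in the form: there are
`η > 0` and real coefficients `b` with `b(1) = 1`, `g(n) = ∑_{δ ∣ n} b(δ) (n/δ)⁻¹` (i.e.
`∑ g(n) n^{−s} = ζ(s+1) ∑ b(δ) δ^{−s}`, by uniqueness of Dirichlet coefficients, Mathlib's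
`LSeries.eq_of_LSeries_eventually_eq`), and `∑_δ |b(δ)| δ^{η} < ∞` (whence
`∑_{δ ≥ z} |b(δ)| ≤ z^{−η} ∑_δ |b(δ)| δ^{η}`). [cite: FriedlanderIwaniecPisa1978, Lemma 6 (K = Q)] -/
theorem FI1978_lemma6_rat (A : SieveSequence) (h1 : A.BombieriA1) (h5 : A.BombieriA5) :
    ∃ η : ℝ, 0 < η ∧ ∃ b : ℕ → ℝ, b 1 = 1 ∧
      (∀ n : ℕ, n ≠ 0 → A.density n = ∑ d ∈ n.divisors, b d / ((n / d : ℕ) : ℝ)) ∧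
      Summable (fun n : ℕ => |b n| * (n : ℝ) ^ η) := by
  obtain ⟨η₁, hη₁, b, hb, -, hLS⟩ := h5
  set g : ℕ → ℂ := fun d => ((A.density d : ℝ) : ℂ) with hg
  set ι : ℕ → ℂ := fun n => ((n : ℂ))⁻¹ with hι
  have hgabs : LSeries.abscissaOfAbsConv g ≤ 1 := by
    obtain ⟨C, hC⟩ := h1.1 1 one_pos
    refine LSeries.abscissaOfAbsConv_le_of_le_const ⟨C, fun n hn => ?_⟩
    have := hC n (Nat.one_le_iff_ne_zero.mpr hn)
    rw [show (-1 : ℝ) + 1 = 0 by norm_num, Real.rpow_zero, mul_one] at this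
    rw [hg]
    dsimp only
    rwa [Complex.norm_real, Real.norm_eq_abs]
  have hιabs : LSeries.abscissaOfAbsConv ι ≤ 1 := by
    refine LSeries.abscissaOfAbsConv_le_of_le_const ⟨1, fun n hn => ?_⟩
    rw [hι]
    dsimp only
    rw [norm_inv, Complex.norm_natCast]
    exact inv_le_one_of_one_le₀ (by exact_mod_cast Nat.one_le_iff_ne_zero.mpr hn)
  have hbabs : LSeries.abscissaOfAbsConv b ≤ 0 := by
    have := (hb 0 (by simp [hη₁])).abscissaOfAbsConv_le
    simpa using this
  have hzeta : ∀ s : ℂ, 1 < s.re → riemannZeta (s + 1) = LSeries ι s := by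
    intro s hs
    have hs1 : 1 < (s + 1).re := by simp only [Complex.add_re, Complex.one_re]; linarith
    rw [← LSeries_one_eq_riemannZeta hs1, LSeries, LSeries]
    refine tsum_congr fun n => ?_
    rcases eq_or_ne n 0 with rfl | hn
    · simp [LSeries.term_zero]
    · have hn' : (n : ℂ) ≠ 0 := Nat.cast_ne_zero.mpr hn
      rw [LSeries.term_of_ne_zero hn, LSeries.term_of_ne_zero hn, Pi.one_apply, hι]
      dsimp only
      rw [Complex.cpow_add _ _ hn', Complex.cpow_one]
      field_simp
  have hconv : ∀ x : ℝ, 1 < x → LSeries g x = LSeries (LSeries.convolution ι b) x := by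
    intro x hx
    have hxre : (1 : ℝ) < (x : ℂ).re := by simpa using hx
    have hιs : LSeriesSummable ι x :=
      LSeriesSummable_of_abscissaOfAbsConv_lt_re (hιabs.trans_lt (by exact_mod_cast hxre))
    have hx1 : -η₁ < (x : ℂ).re := by rw [Complex.ofReal_re]; linarith
    have hx2 : 0 < (x : ℂ).re := by rw [Complex.ofReal_re]; linarith
    have hbs : LSeriesSummable b x := hb x hx1
    rw [LSeries_convolution' hιs hbs, ← hzeta x hxre]
    exact hLS x hx2
  have h1top : (1 : EReal) < ⊤ := EReal.coe_lt_top 1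
  have h0top : (0 : EReal) < ⊤ := EReal.coe_lt_top 0
  have hconvabs : LSeries.abscissaOfAbsConv (LSeries.convolution ι b) < ⊤ :=
    (LSeries.abscissaOfAbsConv_convolution_le ι b).trans_lt
      (max_lt (hιabs.trans_lt h1top) (hbabs.trans_lt h0top))
  have heq : ∀ n : ℕ, n ≠ 0 → g n = (LSeries.convolution ι b) n := fun n hn =>
    LSeries.eq_of_LSeries_eventually_eq (hgabs.trans_lt h1top) hconvabs
      ((eventually_gt_atTop 1).mono fun x hx => hconv x hx) hn
  -- the identity `g n = ∑_{d ∣ n} b d / (n/d)`, real parts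
  have hsum : ∀ n : ℕ, n ≠ 0 → A.density n = ∑ d ∈ n.divisors, (b d).re / ((n / d : ℕ) : ℝ) := by
    intro n hn
    have := heq n hn
    rw [LSeries.convolution_def] at this
    dsimp only at this
    rw [Nat.sum_divisorsAntidiagonal' (fun i j => ι i * b j)] at this
    have hre := congrArg Complex.re this
    rw [hg] at hre
    dsimp only at hre
    rw [Complex.ofReal_re, Complex.re_sum] at hre
    rw [hre]
    refine Finset.sum_congr rfl fun d _ => ?_
    rw [hι]
    dsimp only
    rw [show ((n / d : ℕ) : ℂ)⁻¹ = ((((n / d : ℕ) : ℝ)⁻¹ : ℝ) : ℂ) by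
      rw [Complex.ofReal_inv, Complex.ofReal_natCast], Complex.re_ofReal_mul, div_eq_mul_inv, mul_comm]
  have hg1 : A.density 1 = 1 := A.density_mult.map_one
  have hb1 : (b 1).re = 1 := by
    have := hsum 1 one_ne_zero
    rw [hg1, Nat.divisors_one, Finset.sum_singleton, Nat.div_self one_pos, Nat.cast_one, div_one]
      at this
    exact this.symm
  refine ⟨η₁ / 2, by positivity, fun n => (b n).re, hb1, hsum, ?_⟩
  have hs : LSeriesSummable b (-(((η₁ / 2 : ℝ)) : ℂ)) :=
    hb _ (by simp only [Complex.neg_re, Complex.ofReal_re]; linarith)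
  have hnorm : Summable fun n : ℕ => ‖LSeries.term b (-((η₁ / 2 : ℝ) : ℂ)) n‖ :=
    summable_norm_iff.mpr hs
  refine hnorm.of_nonneg_of_le (fun n => by positivity) (fun n => ?_)
  rcases eq_or_ne n 0 with rfl | hn
  · rw [Nat.cast_zero, Real.zero_rpow (by positivity), mul_zero]
    exact norm_nonneg _
  · rw [LSeries.norm_term_eq, if_neg hn, show (-((η₁ / 2 : ℝ) : ℂ)).re = -(η₁ / 2) by simp,
      Real.rpow_neg (Nat.cast_nonneg n), div_inv_eq_mul]
    exact mul_le_mul_of_nonneg_right (Complex.abs_re_le_norm _) (by positivity)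

/-- Under (A₁), (A₅): `g(p) − 1/p = b(p)` at primes, so `∑_p |g(p) − 1/p| < ∞`. [folklore] -/
theorem summable_prime_density_sub_inv (A : SieveSequence) (h1 : A.BombieriA1) (h5 : A.BombieriA5) :
    Summable (fun n : ℕ => if n.Prime then |A.density n - (n : ℝ)⁻¹| else 0) := by
  obtain ⟨η, hη, b, hb1, hgb, hbs⟩ := FI1978_lemma6_rat A h1 h5
  refine hbs.of_nonneg_of_le (fun n => by split_ifs <;> positivity) (fun n => ?_)
  split_ifs with hp
  · have h := hgb n hp.ne_zero
    rw [hp.divisors, Finset.sum_pair hp.one_lt.ne, Nat.div_one, Nat.div_self hp.pos, hb1,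
      Nat.cast_one, div_one, one_div] at h
    rw [h, add_sub_cancel_left]
    exact le_mul_of_one_le_right (abs_nonneg _)
      (Real.one_le_rpow (by exact_mod_cast hp.one_lt.le) hη.le)
  · positivity

/-- Under (A₁), (A₅): `∑_p |g(p) − 1/p| p^{η} < ∞` for the `η` of `FI1978_lemma6_rat`
(`g(p) − 1/p = b(p)` at primes). [folklore] -/
theorem summable_abs_density_sub_inv (A : SieveSequence) (h1 : A.BombieriA1) (h5 : A.BombieriA5) :
    ∃ η : ℝ, 0 < η ∧
      Summable (fun n : ℕ => if n.Prime then |A.density n - (n : ℝ)⁻¹| * (n : ℝ) ^ η else 0) := by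
  obtain ⟨η, hη, b, hb1, hgb, hbs⟩ := FI1978_lemma6_rat A h1 h5
  refine ⟨η, hη, hbs.of_nonneg_of_le (fun n => by split_ifs <;> positivity) (fun n => ?_)⟩
  split_ifs with hp
  · have h := hgb n hp.ne_zero
    rw [hp.divisors, Finset.sum_pair hp.one_lt.ne, Nat.div_one, Nat.div_self hp.pos, hb1,
      Nat.cast_one, div_one, one_div] at h
    rw [h, add_sub_cancel_left]
  · positivity

/-! ### Lemma 7 for `K = ℚ`, `N = 1` -/

/-- **Structure of `V(z)` under (A₁), (A₅)** (the content of the proof of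
[FriedlanderIwaniecPisa1978] Lemma 7 for `K = ℚ`, `N = 1`): there are `H > 0` with
`A.HasDensityConstant H`, `η > 0` and `M ≥ 0` such that for every `z ≥ 2`,
`V(z) = ∏_{p<z}(1 − g(p)) = H ∏_{p<z}(1 − 1/p) · e^{−R}` with `|R| ≤ M z^{−η}` and `|R| ≤ M`
(`R` = the tail `∑_{p ≥ z} log((1 − g(p))/(1 − 1/p))`, `M = ∑_p |log(…)| p^{η}`). Both Lemma 7
(`FI1978_lemma7_rat`) and the two-sided comparison `e^{−M} H P(z) ≤ V(z) ≤ e^{M} H P(z)`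
(`densityProduct_bounds`, the input for the sieve-dimension condition of Lemmata 11–12) follow.
[cite: FriedlanderIwaniecPisa1978, Lemma 7 (K = Q, N = 1), proof] -/
theorem densityProduct_eq_exp (A : SieveSequence) (hA : A.IsBombieriSequence) :
    ∃ H : ℝ, 0 < H ∧ A.HasDensityConstant H ∧ ∃ η : ℝ, 0 < η ∧ ∃ M : ℝ, 0 ≤ M ∧ ∀ z : ℝ, 2 ≤ z →
      ∃ R : ℝ, |R| ≤ z ^ (-η) * M ∧ |R| ≤ M ∧
        A.densityProduct (primesProdBelow z) =
          H * (∏ p ∈ Nat.primesBelow ⌈z⌉₊, (1 - (p : ℝ)⁻¹)) * Real.exp (-R) := by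
  obtain ⟨-, h1, -, -, -, h5⟩ := hA
  obtain ⟨η, hη, hW⟩ := summable_abs_density_sub_inv A h1 h5
  -- the factors and their logarithms
  set t : ℕ → ℝ :=
    fun n => if n.Prime then Real.log ((1 - A.density n) / (1 - (n : ℝ)⁻¹)) else 0 with ht
  have htp : ∀ n : ℕ, n.Prime → t n = Real.log ((1 - A.density n) / (1 - (n : ℝ)⁻¹)) :=
    fun n hn => by rw [ht]; dsimp only; rw [if_pos hn]
  have htn : ∀ n : ℕ, ¬ n.Prime → t n = 0 := fun n hn => by rw [ht]; dsimp only; rw [if_neg hn]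
  have hqpos : ∀ p : ℕ, p.Prime → 0 < 1 - (p : ℝ)⁻¹ := fun p hp =>
    sub_pos.mpr (inv_lt_one_of_one_lt₀ (by exact_mod_cast hp.one_lt))
  have hFpos : ∀ p : ℕ, p.Prime → 0 < (1 - A.density p) / (1 - (p : ℝ)⁻¹) := fun p hp =>
    div_pos (sub_pos.mpr (h1.2 p hp.one_lt)) (hqpos p hp)
  -- (i) `∑ |t n| n^η < ∞`
  have hev : ∀ᶠ n : ℕ in cofinite, ‖|t n| * (n : ℝ) ^ η‖ ≤
      4 * (if n.Prime then |A.density n - (n : ℝ)⁻¹| * (n : ℝ) ^ η else 0) := by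
    have hW0 := hW.tendsto_cofinite_zero
    rw [Nat.cofinite_eq_atTop] at hW0 ⊢
    filter_upwards [(tendsto_order.1 hW0).2 (1 / 4) (by norm_num), eventually_ge_atTop 2]
      with n hn hn2
    by_cases hp : n.Prime
    · rw [if_pos hp] at hn ⊢
      rw [htp n hp, Real.norm_of_nonneg (by positivity)]
      have hn1 : (1 : ℝ) ≤ (n : ℝ) ^ η := Real.one_le_rpow (by exact_mod_cast hp.one_lt.le) hη.le
      have hdl : |A.density n - (n : ℝ)⁻¹| ≤ 1 / 4 := by
        have : |A.density n - (n : ℝ)⁻¹| ≤ |A.density n - (n : ℝ)⁻¹| * (n : ℝ) ^ η :=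
          le_mul_of_one_le_right (abs_nonneg _) hn1
        linarith
      have hn2' : (2 : ℝ) ≤ n := by exact_mod_cast hn2
      have hq : (1 : ℝ) / 2 ≤ 1 - (n : ℝ)⁻¹ := by
        have : (n : ℝ)⁻¹ ≤ 2⁻¹ := (inv_le_inv₀ (by linarith) two_pos).mpr hn2'
        linarith
      calc |Real.log ((1 - A.density n) / (1 - (n : ℝ)⁻¹))| * (n : ℝ) ^ η
          ≤ (4 * |A.density n - (n : ℝ)⁻¹|) * (n : ℝ) ^ η := by
            gcongr
            exact abs_log_factor_le hq hdl
        _ = 4 * (|A.density n - (n : ℝ)⁻¹| * (n : ℝ) ^ η) := by ring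
    · rw [if_neg hp, htn n hp, abs_zero, zero_mul, norm_zero, mul_zero]
  have hTsum : Summable fun n : ℕ => |t n| * (n : ℝ) ^ η :=
    Summable.of_norm_bounded_eventually (hW.mul_left 4) hev
  obtain ⟨htsum, -⟩ := abs_tsum_sub_sum_range_le hη.le hTsum le_rfl
  set T := ∑' n, t n with hT
  set M := ∑' n, |t n| * (n : ℝ) ^ η with hM
  have hM0 : 0 ≤ M := tsum_nonneg fun n => by positivity
  -- (ii) partial products are exponentials of partial sums
  have hprod : ∀ s : Finset ℕ, (∀ p ∈ s, p.Prime) →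
      ∏ p ∈ s, (1 - A.density p) / (1 - (p : ℝ)⁻¹) = Real.exp (∑ p ∈ s, t p) := by
    intro s hs
    rw [Real.exp_sum]
    refine Finset.prod_congr rfl fun p hp => ?_
    rw [htp p (hs p hp), Real.exp_log (hFpos p (hs p hp))]
  -- (iii) `H = e^T > 0` is the density constant
  set H := Real.exp T with hH
  have hHpos : 0 < H := Real.exp_pos T
  have hDC : A.HasDensityConstant H := by
    have h1' : ∀ x : ℕ, ∏ p ∈ Nat.primesLE x, (1 - A.density p) / (1 - (p : ℝ)⁻¹) =
        Real.exp (∑ n ∈ Finset.range (x + 1), t n) := by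
      intro x
      rw [hprod _ (fun p hp => Nat.prime_of_mem_primesLE hp), ← sum_primesBelow_eq_sum_range htn]
      rfl
    change Tendsto (fun x : ℕ => ∏ p ∈ Nat.primesLE x, (1 - A.density p) / (1 - (p : ℝ)⁻¹))
      atTop (𝓝 H)
    simp_rw [h1']
    exact (Real.continuous_exp.tendsto T).comp
      (htsum.hasSum.tendsto_sum_nat.comp (tendsto_add_atTop_nat 1))
  -- (iv) conclusion
  refine ⟨H, hHpos, hDC, η, hη, M, hM0, fun z hz => ?_⟩
  set N := ⌈z⌉₊ with hN
  have hz0 : 0 < z := by linarith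
  have hz1 : 1 < z := by linarith
  have hzN : z ≤ N := Nat.le_ceil z
  have hN1 : 1 ≤ N := by
    have : (1 : ℝ) ≤ N := by linarith
    exact_mod_cast this
  set P := ∏ p ∈ Nat.primesBelow N, (1 - (p : ℝ)⁻¹) with hP
  have hPpos : 0 < P := Finset.prod_pos fun p hp => hqpos p (Nat.prime_of_mem_primesBelow hp)
  set S := ∑ n ∈ Finset.range N, t n with hS
  set R := T - S with hR
  have hRle : |R| ≤ z ^ (-η) * M :=
    (abs_tsum_sub_sum_range_le hη.le hTsum hN1).2.trans (mul_le_mul_of_nonneg_right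
      (Real.rpow_le_rpow_of_nonpos hz0 hzN (by linarith)) hM0)
  have hz_η : z ^ (-η) ≤ 1 := Real.rpow_le_one_of_one_le_of_nonpos hz1.le (by linarith)
  have hzη0 : 0 ≤ z ^ (-η) := Real.rpow_nonneg hz0.le _
  have hRM : |R| ≤ M := hRle.trans (mul_le_of_le_one_left hM0 hz_η)
  -- `V(z) = P e^{S} = H P e^{−R}`
  have hV : A.densityProduct (primesProdBelow z) = H * P * Real.exp (-R) := by
    have hV1 : A.densityProduct (primesProdBelow z) =
        ∏ p ∈ Nat.primesBelow N, ((1 - A.density p) / (1 - (p : ℝ)⁻¹) * (1 - (p : ℝ)⁻¹)) := by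
      rw [SieveSequence.densityProduct, primeFactors_primesProdBelow]
      refine Finset.prod_congr rfl fun p hp => ?_
      rw [div_mul_cancel₀ _ (hqpos p (Nat.prime_of_mem_primesBelow hp)).ne']
    rw [hV1, Finset.prod_mul_distrib, hprod _ (fun p hp => Nat.prime_of_mem_primesBelow hp),
      sum_primesBelow_eq_sum_range htn N, ← hS, ← hP, hH, hR, mul_right_comm, ← Real.exp_add]
    congr 1
    ring_nf
  exact ⟨R, hRle, hRM, hV⟩

/-- **[FriedlanderIwaniecPisa1978] Lemma 7 for `K = ℚ`, `N = 1`, proved** (p. 736: "For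
`z ≥ 2 + (log N)²` we have `∏_{p<z} (1 − 1/f(p)) = H′ ∏_{p<z} (1 − 1/p)^{b(p)} {1 + O(z^{−η})} ≪
(log z)^{−1}`, where `H′ = ∏_p (1 − 1/f(p))(1 − 1/p)^{−b(p)}`"; `b(p) = 1`, `N = 1`). This is the
statement of the named fact `FI1978_lemma7` of `BombieriAsymptoticSieve.lean` (whose discharge
`FI1978_lemma7_holds` is the one-line application of this theorem). Proof (`densityProduct_eq_exp`): write
`(1 − g(p))/(1 − 1/p) = 1 + u_p` with `|u_p| ≤ 2|g(p) − 1/p|`; by `summable_abs_density_sub_inv`,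
`∑_p |log(1 + u_p)| p^{η} = M < ∞`, so the ordered partial products
`∏_{p ≤ x} (1 + u_p) = exp(∑_{p ≤ x} log(1 + u_p))` converge to `H = e^T > 0`
(`T = ∑_p log(1 + u_p)`), with tail `|T − ∑_{p < z}| ≤ M z^{−η}`; hence
`V(z) = H ∏_{p<z}(1 − 1/p) e^{−R}`, `|R| ≤ M z^{−η}`, `|e^{−R} − 1| ≤ M e^{M} z^{−η}`, and
`V(z) ≤ H e^{M} ∏_{p<z}(1 − 1/p) ≤ H e^{M}/log z` (`prod_primesBelow_one_sub_inv_le`).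
[cite: FriedlanderIwaniecPisa1978, Lemma 7 (K = Q, N = 1)] -/
theorem FI1978_lemma7_rat (A : SieveSequence) (hA : A.IsBombieriSequence) :
    ∃ H : ℝ, 0 < H ∧ A.HasDensityConstant H ∧ ∃ η : ℝ, 0 < η ∧ ∃ C : ℝ, ∀ z : ℝ, 2 ≤ z →
      |A.densityProduct (primesProdBelow z) - H * ∏ p ∈ Nat.primesBelow ⌈z⌉₊, (1 - (p : ℝ)⁻¹)| ≤
          C * z ^ (-η) * (H * ∏ p ∈ Nat.primesBelow ⌈z⌉₊, (1 - (p : ℝ)⁻¹)) ∧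
        A.densityProduct (primesProdBelow z) ≤ C / Real.log z := by
  obtain ⟨H, hHpos, hDC, η, hη, M, hM0, hcore⟩ := densityProduct_eq_exp A hA
  refine ⟨H, hHpos, hDC, η, hη, max (M * Real.exp M) (H * Real.exp M), fun z hz => ?_⟩
  obtain ⟨R, hRle, hRM, hV⟩ := hcore z hz
  have hz0 : 0 < z := by linarith
  have hz1 : 1 < z := by linarith
  set P := ∏ p ∈ Nat.primesBelow ⌈z⌉₊, (1 - (p : ℝ)⁻¹) with hP
  have hPpos : 0 < P := Finset.prod_pos fun p hp =>
    sub_pos.mpr (inv_lt_one_of_one_lt₀ (by exact_mod_cast (Nat.prime_of_mem_primesBelow hp).one_lt))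
  have hzη0 : 0 ≤ z ^ (-η) := Real.rpow_nonneg hz0.le _
  have hexp : |Real.exp (-R) - 1| ≤ (M * Real.exp M) * z ^ (-η) := by
    refine (abs_exp_sub_one_le (-R)).trans ?_
    rw [abs_neg]
    calc |R| * Real.exp |R| ≤ (z ^ (-η) * M) * Real.exp M := by
          gcongr
      _ = (M * Real.exp M) * z ^ (-η) := by ring
  constructor
  · rw [hV, show H * P * Real.exp (-R) - H * P = (H * P) * (Real.exp (-R) - 1) by ring, abs_mul,
      abs_of_pos (mul_pos hHpos hPpos)]
    calc H * P * |Real.exp (-R) - 1| ≤ H * P * ((M * Real.exp M) * z ^ (-η)) :=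
          mul_le_mul_of_nonneg_left hexp (mul_pos hHpos hPpos).le
      _ = (M * Real.exp M) * z ^ (-η) * (H * P) := by ring
      _ ≤ max (M * Real.exp M) (H * Real.exp M) * z ^ (-η) * (H * P) := by
          gcongr
          exact le_max_left _ _
  · have hlogz : 0 < Real.log z := Real.log_pos hz1
    have hPle : P ≤ 1 / Real.log z := prod_primesBelow_one_sub_inv_le hz1
    have hexpR : Real.exp (-R) ≤ Real.exp M := Real.exp_le_exp.mpr ((neg_le_abs R).trans hRM)
    rw [hV]
    calc H * P * Real.exp (-R) ≤ H * P * Real.exp M := by gcongr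
      _ = (H * Real.exp M) * P := by ring
      _ ≤ (H * Real.exp M) * (1 / Real.log z) := by gcongr
      _ = (H * Real.exp M) / Real.log z := by ring
      _ ≤ max (M * Real.exp M) (H * Real.exp M) / Real.log z := by
          gcongr
          exact le_max_right _ _


/-- **Two-sided comparison** `e^{−M} H ∏_{p<z}(1 − 1/p) ≤ ∏_{p<z}(1 − g(p)) ≤
e^{M} H ∏_{p<z}(1 − 1/p)` for all `z ≥ 2`, uniformly (from `densityProduct_eq_exp`); with the
Mertens quotient bounds this gives the dimension-`1` condition
`∏_{w ≤ p < z}(1 − g(p))⁻¹ ≪ log z / log w` needed to apply the fundamental lemma to `𝒜`.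
[folklore] -/
theorem densityProduct_bounds (A : SieveSequence) (hA : A.IsBombieriSequence) :
    ∃ H : ℝ, 0 < H ∧ A.HasDensityConstant H ∧ ∃ K : ℝ, 1 ≤ K ∧ ∀ z : ℝ, 2 ≤ z →
      K⁻¹ * (H * ∏ p ∈ Nat.primesBelow ⌈z⌉₊, (1 - (p : ℝ)⁻¹)) ≤ A.densityProduct (primesProdBelow z) ∧
        A.densityProduct (primesProdBelow z) ≤ K * (H * ∏ p ∈ Nat.primesBelow ⌈z⌉₊, (1 - (p : ℝ)⁻¹)) := by
  obtain ⟨H, hHpos, hDC, η, hη, M, hM0, hcore⟩ := densityProduct_eq_exp A hA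
  refine ⟨H, hHpos, hDC, Real.exp M, Real.one_le_exp hM0, fun z hz => ?_⟩
  obtain ⟨R, -, hRM, hV⟩ := hcore z hz
  have hPpos : 0 < ∏ p ∈ Nat.primesBelow ⌈z⌉₊, (1 - (p : ℝ)⁻¹) := Finset.prod_pos fun p hp =>
    sub_pos.mpr (inv_lt_one_of_one_lt₀ (by exact_mod_cast (Nat.prime_of_mem_primesBelow hp).one_lt))
  have hHP : 0 < H * ∏ p ∈ Nat.primesBelow ⌈z⌉₊, (1 - (p : ℝ)⁻¹) := mul_pos hHpos hPpos
  have hR1 : Real.exp (-R) ≤ Real.exp M := Real.exp_le_exp.mpr ((neg_le_abs R).trans hRM)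
  have hR2 : (Real.exp M)⁻¹ ≤ Real.exp (-R) := by
    rw [← Real.exp_neg]
    exact Real.exp_le_exp.mpr (by linarith [le_abs_self R])
  rw [hV]
  constructor
  · rw [mul_comm]
    exact mul_le_mul_of_nonneg_left hR2 hHP.le
  · rw [mul_comm (Real.exp M)]
    exact mul_le_mul_of_nonneg_left hR1 hHP.le

/-! ### Lemma 8 for `K = ℚ` -/

/-- Local Euler factors under (A₁): with `|g(d)| ≤ C₁ d^{−3/4}` (`d ≥ 1`), for every prime `p` the
series `∑_e |g(p^e)|` converges and
`∑_e |g(p^e)| ≤ 1 + |g(p)| + K₀ C₁ p^{−3/2}`, `K₀ = (1 − 2^{−3/4})⁻¹`. [folklore] -/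
theorem tsum_abs_density_pow_le (A : SieveSequence) {C₁ : ℝ}
    (hC : ∀ d : ℕ, 1 ≤ d → |A.density d| ≤ C₁ * (d : ℝ) ^ (-(3 / 4 : ℝ))) {p : ℕ} (hp : p.Prime) :
    Summable (fun e : ℕ => |A.density (p ^ e)|) ∧
      ∑' e : ℕ, |A.density (p ^ e)| ≤
        1 + |A.density p| + (1 - (2 : ℝ) ^ (-(3 / 4 : ℝ)))⁻¹ * C₁ * (p : ℝ) ^ (-(3 / 2 : ℝ)) := by
  have hp1 : (1 : ℝ) < p := by exact_mod_cast hp.one_lt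
  have hp0 : (0 : ℝ) < p := by linarith
  have hp2 : (2 : ℝ) ≤ p := by exact_mod_cast hp.two_le
  have hC0 : 0 ≤ C₁ := by
    have := hC 1 le_rfl
    rw [A.density_mult.map_one, Nat.cast_one, Real.one_rpow, mul_one] at this
    linarith [abs_nonneg (1 : ℝ)]
  set r : ℝ := (p : ℝ) ^ (-(3 / 4 : ℝ)) with hr
  have hr0 : 0 ≤ r := Real.rpow_nonneg hp0.le _
  have hr2 : r ≤ (2 : ℝ) ^ (-(3 / 4 : ℝ)) := Real.rpow_le_rpow_of_nonpos two_pos hp2 (by norm_num)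
  have h2r : (2 : ℝ) ^ (-(3 / 4 : ℝ)) < 1 :=
    Real.rpow_lt_one_of_one_lt_of_neg (by norm_num) (by norm_num)
  have hr1 : r < 1 := hr2.trans_lt h2r
  set K₀ : ℝ := (1 - (2 : ℝ) ^ (-(3 / 4 : ℝ)))⁻¹ with hK₀
  have hK₀0 : 0 < K₀ := inv_pos.mpr (by linarith)
  -- pointwise geometric bound
  have hpt : ∀ e : ℕ, |A.density (p ^ e)| ≤ C₁ * r ^ e := by
    intro e
    have h := hC (p ^ e) (Nat.one_le_pow e p hp.pos)
    have hre : (((p ^ e : ℕ) : ℝ)) ^ (-(3 / 4 : ℝ)) = r ^ e := by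
      rw [Nat.cast_pow, ← Real.rpow_natCast (p : ℝ) e, ← Real.rpow_mul hp0.le, mul_comm,
        Real.rpow_mul hp0.le, Real.rpow_natCast]
    rwa [hre] at h
  have hgeom : Summable fun e : ℕ => C₁ * r ^ e := (summable_geometric_of_lt_one hr0 hr1).mul_left C₁
  have hsum : Summable fun e : ℕ => |A.density (p ^ e)| :=
    hgeom.of_nonneg_of_le (fun e => abs_nonneg _) hpt
  refine ⟨hsum, ?_⟩
  rw [hsum.tsum_eq_zero_add, ((summable_nat_add_iff 1).mpr hsum).tsum_eq_zero_add]
  simp only [zero_add, pow_zero, pow_one, A.density_mult.map_one, abs_one]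
  -- the tail `∑_e |g(p^(e+2))| ≤ C₁ r² (1 − r)⁻¹ ≤ K₀ C₁ p^{−3/2}`
  have htail : ∑' e : ℕ, |A.density (p ^ (e + 1 + 1))| ≤ K₀ * C₁ * (p : ℝ) ^ (-(3 / 2 : ℝ)) := by
    have hs2 : Summable fun e : ℕ => |A.density (p ^ (e + 1 + 1))| :=
      (summable_nat_add_iff 2).mpr hsum
    have hg2 : Summable fun e : ℕ => C₁ * r ^ 2 * r ^ e :=
      (summable_geometric_of_lt_one hr0 hr1).mul_left _
    calc ∑' e : ℕ, |A.density (p ^ (e + 1 + 1))| ≤ ∑' e : ℕ, C₁ * r ^ 2 * r ^ e := by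
          refine hs2.tsum_le_tsum (fun e => ?_) hg2
          calc |A.density (p ^ (e + 1 + 1))| ≤ C₁ * r ^ (e + 1 + 1) := hpt _
            _ = C₁ * r ^ 2 * r ^ e := by ring
      _ = C₁ * r ^ 2 * (1 - r)⁻¹ := by rw [tsum_mul_left, tsum_geometric_of_lt_one hr0 hr1]
      _ ≤ C₁ * r ^ 2 * K₀ := by
          refine mul_le_mul_of_nonneg_left ?_ (by positivity)
          exact inv_anti₀ (by linarith) (by linarith)
      _ = K₀ * C₁ * r ^ 2 := by ring
      _ = K₀ * C₁ * (p : ℝ) ^ (-(3 / 2 : ℝ)) := by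
          rw [hr, ← Real.rpow_natCast, ← Real.rpow_mul hp0.le]
          norm_num
  linarith

/-- **[FriedlanderIwaniecPisa1978] Lemma 8 for `K = ℚ`** (p. 737: "For `2 ≤ z < x`, we have
`∑_{d ≤ x, (d, P(z)) = 1} 1/f(d) ≪ log x / log z`. PROOF. We have `f(d) ≥ f̃(d)` and
`∑ 1/f̃(d) ≤ ∏_{z ≤ p ≤ x} (1 + 1/f̃(p) + 1/f̃(p²) + …) ≪ ∏_{z ≤ p ≤ x} (1 + 1/p)^{b(p)} ≪
log x/log z`"), proved here with `|1/f(d)|` in place of `1/f(d)` (Bombieri's (A₁) does not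
include `f > 0`), from (A₁) (`|g(p^e)| ≤ C₁ p^{−3e/4}`), (A₅) (`∑_p |g(p) − 1/p| < ∞`,
`FI1978_lemma6_rat`) and Mertens (`prod_primesGe_one_add_inv_le`): the constant is
`e⁵ exp(∑_p (|g(p) − 1/p| + K₀ C₁ p^{−3/2}))`. [cite: FriedlanderIwaniecPisa1978, Lemma 8 (K = Q)] -/
theorem FI1978_lemma8_rat (A : SieveSequence) (h1 : A.BombieriA1) (h5 : A.BombieriA5) :
    ∃ C : ℝ, ∀ x z : ℝ, 2 ≤ z → z ≤ x →
      ∑ d ∈ (Finset.Ioc 0 ⌊x⌋₊).filter (fun d : ℕ => d.Coprime (primesProdBelow z)),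
        |A.density d| ≤ C * Real.log x / Real.log z := by
  -- (A₁) with `ε = 1/4`
  obtain ⟨C₁, hC₁⟩ := h1.1 (1 / 4) (by norm_num)
  have hC : ∀ d : ℕ, 1 ≤ d → |A.density d| ≤ C₁ * (d : ℝ) ^ (-(3 / 4 : ℝ)) := fun d hd => by
    have := hC₁ d hd; rwa [show (-1 + 1 / 4 : ℝ) = -(3 / 4) by norm_num] at this
  have hC0 : 0 ≤ C₁ := by
    have := hC 1 le_rfl
    rw [A.density_mult.map_one, Nat.cast_one, Real.one_rpow, mul_one] at this
    linarith [abs_nonneg (1 : ℝ)]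
  set K₀ : ℝ := (1 - (2 : ℝ) ^ (-(3 / 4 : ℝ)))⁻¹ with hK₀
  have h2r : (2 : ℝ) ^ (-(3 / 4 : ℝ)) < 1 :=
    Real.rpow_lt_one_of_one_lt_of_neg (by norm_num) (by norm_num)
  have hK₀0 : 0 < K₀ := inv_pos.mpr (by linarith)
  -- the summable majorant `u`
  set u : ℕ → ℝ := fun n => if n.Prime then
      |A.density n - (n : ℝ)⁻¹| + K₀ * C₁ * (n : ℝ) ^ (-(3 / 2 : ℝ)) else 0 with hu
  have hu0 : ∀ n, 0 ≤ u n := fun n => by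
    rw [hu]; dsimp only; split_ifs <;> positivity
  have hus : Summable u := by
    have hA := summable_prime_density_sub_inv A h1 h5
    have hB : Summable fun n : ℕ => K₀ * C₁ * (n : ℝ) ^ (-(3 / 2 : ℝ)) := by
      refine Summable.mul_left _ ?_
      have := Real.summable_nat_rpow_inv.mpr (by norm_num : (1 : ℝ) < 3 / 2)
      exact this.congr fun n => by rw [Real.rpow_neg (Nat.cast_nonneg n)]
    refine (hA.add hB).of_nonneg_of_le hu0 fun n => ?_
    rw [hu]; dsimp only
    split_ifs with hp
    · exact le_rfl
    · rw [zero_add]; positivity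
  set U := ∑' n, u n with hU
  refine ⟨Real.exp 5 * Real.exp U, fun x z hz hzx => ?_⟩
  have hz1 : 1 < z := by linarith
  have hlogz : 0 < Real.log z := Real.log_pos hz1
  have hlogx : 0 < Real.log x := Real.log_pos (by linarith)
  set s := (Nat.primesLE ⌊x⌋₊).filter (fun p : ℕ => z ≤ (p : ℝ)) with hs
  have hsP : ∀ p ∈ s, p.Prime := fun p hp => (mem_primesGe.mp hp).1
  -- step 1: Euler product bound
  have hmulg : ∀ {m n : ℕ}, Nat.Coprime m n → |A.density (m * n)| = |A.density m| * |A.density n| :=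
    fun {m n} hmn => by rw [A.density_mult.map_mul_of_coprime hmn, abs_mul]
  have hstep1 : ∑ d ∈ (Finset.Ioc 0 ⌊x⌋₊).filter (fun d : ℕ => d.Coprime (primesProdBelow z)),
      |A.density d| ≤ ∏ p ∈ s, ∑' e : ℕ, |A.density (p ^ e)| :=
    sum_le_prod_tsum_of_factored (h := fun n => |A.density n|)
      (by rw [A.density_mult.map_one, abs_one]) hmulg (fun n => abs_nonneg _)
      (fun hp => (tsum_abs_density_pow_le A hC hp).1) hsP
      (fun d hd => mem_factoredNumbers_of_rough hd)
  -- step 2: each factor is at most `(1 + 1/p)(1 + u p)`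
  have hstep2 : ∏ p ∈ s, ∑' e : ℕ, |A.density (p ^ e)| ≤ ∏ p ∈ s, ((1 + (p : ℝ)⁻¹) * (1 + u p)) := by
    refine Finset.prod_le_prod (fun p _ => tsum_nonneg fun e => abs_nonneg _) fun p hp => ?_
    have hp := hsP p hp
    have hb := (tsum_abs_density_pow_le A hC hp).2
    have hup : u p = |A.density p - (p : ℝ)⁻¹| + K₀ * C₁ * (p : ℝ) ^ (-(3 / 2 : ℝ)) := by
      rw [hu]; dsimp only; rw [if_pos hp]
    have htri : |A.density p| ≤ (p : ℝ)⁻¹ + |A.density p - (p : ℝ)⁻¹| := by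
      have := abs_add_le ((p : ℝ)⁻¹) (A.density p - (p : ℝ)⁻¹)
      have hpinv : (0 : ℝ) ≤ (p : ℝ)⁻¹ := inv_nonneg.mpr (Nat.cast_nonneg p)
      rw [add_sub_cancel, abs_of_nonneg hpinv] at this
      exact this
    have hcross : 0 ≤ (p : ℝ)⁻¹ * u p := mul_nonneg (inv_nonneg.mpr (Nat.cast_nonneg p)) (hu0 p)
    rw [hup] at hcross ⊢
    nlinarith
  -- step 3: `∏ (1 + u p) ≤ exp U`
  have hstep3 : ∏ p ∈ s, (1 + u p) ≤ Real.exp U := by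
    calc ∏ p ∈ s, (1 + u p) ≤ ∏ p ∈ s, Real.exp (u p) :=
          Finset.prod_le_prod (fun p _ => by linarith [hu0 p]) fun p _ => by
            linarith [Real.add_one_le_exp (u p)]
      _ = Real.exp (∑ p ∈ s, u p) := (Real.exp_sum s u).symm
      _ ≤ Real.exp U := Real.exp_le_exp.mpr (hus.sum_le_tsum s fun n _ => hu0 n)
  have hstep4 := prod_primesGe_one_add_inv_le hz hzx
  rw [← hs] at hstep4
  have hprod0 : 0 ≤ ∏ p ∈ s, (1 + (p : ℝ)⁻¹) := Finset.prod_nonneg fun p _ => by positivity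
  calc ∑ d ∈ (Finset.Ioc 0 ⌊x⌋₊).filter (fun d : ℕ => d.Coprime (primesProdBelow z)), |A.density d|
      ≤ ∏ p ∈ s, ((1 + (p : ℝ)⁻¹) * (1 + u p)) := hstep1.trans hstep2
    _ = (∏ p ∈ s, (1 + (p : ℝ)⁻¹)) * ∏ p ∈ s, (1 + u p) := Finset.prod_mul_distrib
    _ ≤ (Real.exp 5 * Real.log x / Real.log z) * Real.exp U := by gcongr
    _ = Real.exp 5 * Real.exp U * Real.log x / Real.log z := by ring

/-! ### Lemma 9 for `K = ℚ`, `N = 1` -/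

/-- The divisor-sum swap for `∑_{rough d ≤ x} |g(d) − 1/d|` (proof of [FriedlanderIwaniecPisa1978]
Lemma 9, K = ℚ: `∑_{d ≤ x, (d,P(z))=1} |1/f(d) − 1/d| ≪ ∑_d d⁻¹ ∑_{δδ′ = d, δ > 1} |g_δ| …`): if
`g(d) = ∑_{δ ∣ d} b(δ)(d/δ)⁻¹` with `b(1) = 1`, then
`∑_{rough d ≤ x} |g(d) − 1/d| ≤ (∑_{rough δ ≤ x, δ ≠ 1} |b(δ)|) · ∑_{rough m ≤ x} 1/m`. [folklore] -/
theorem sum_rough_abs_density_sub_inv_le (A : SieveSequence) {b : ℕ → ℝ} (hb1 : b 1 = 1)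
    (hgb : ∀ n : ℕ, n ≠ 0 → A.density n = ∑ d ∈ n.divisors, b d / ((n / d : ℕ) : ℝ))
    (x z : ℝ) :
    ∑ d ∈ (Finset.Ioc 0 ⌊x⌋₊).filter (fun d : ℕ => d.Coprime (primesProdBelow z)),
        |A.density d - (d : ℝ)⁻¹| ≤
      (∑ δ ∈ (Finset.Ioc 0 ⌊x⌋₊).filter
          (fun δ : ℕ => δ.Coprime (primesProdBelow z) ∧ δ ≠ 1), |b δ|) *
        ∑ m ∈ (Finset.Ioc 0 ⌊x⌋₊).filter (fun m : ℕ => m.Coprime (primesProdBelow z)),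
          (m : ℝ)⁻¹ := by
  classical
  set N := ⌊x⌋₊ with hN
  set P := primesProdBelow z with hP
  -- the two arithmetic functions and the rough indicator
  set f : ArithmeticFunction ℝ := ⟨fun δ => if δ ≤ 1 then 0 else |b δ|, by simp⟩ with hf
  set gi : ArithmeticFunction ℝ := ⟨fun e => ((e : ℕ) : ℝ)⁻¹, by simp⟩ with hgi
  set a : ℕ → ℝ := fun n => if n.Coprime P then 1 else 0 with ha
  have hf_apply : ∀ δ : ℕ, f δ = if δ ≤ 1 then 0 else |b δ| := fun δ => rfl
  have hgi_apply : ∀ e : ℕ, gi e = ((e : ℕ) : ℝ)⁻¹ := fun e => rfl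
  have hf0 : ∀ δ, 0 ≤ f δ := fun δ => by rw [hf_apply]; split_ifs <;> positivity
  have ha0 : ∀ n, 0 ≤ a n := fun n => by rw [ha]; dsimp only; split_ifs <;> norm_num
  have ha1 : ∀ n, a n ≤ 1 := fun n => by rw [ha]; dsimp only; split_ifs <;> norm_num
  set R := ∑ m ∈ (Finset.Ioc 0 N).filter (fun m : ℕ => m.Coprime P), (m : ℝ)⁻¹ with hR
  have hR0 : 0 ≤ R := Finset.sum_nonneg fun m _ => inv_nonneg.mpr (Nat.cast_nonneg _)
  -- pointwise: `|g d − 1/d| ≤ (f * gi) d` for `d ≠ 0`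
  have hpt : ∀ d : ℕ, d ≠ 0 → |A.density d - (d : ℝ)⁻¹| ≤ (f * gi) d := by
    intro d hd
    have h1mem : 1 ∈ d.divisors := Nat.one_mem_divisors.mpr hd
    have hgd : A.density d - (d : ℝ)⁻¹ = ∑ δ ∈ d.divisors.erase 1, b δ / ((d / δ : ℕ) : ℝ) := by
      rw [hgb d hd, ← Finset.sum_erase_add _ _ h1mem, hb1, Nat.div_one, one_div, add_sub_cancel_right]
    rw [hgd, ArithmeticFunction.mul_apply, Nat.sum_divisorsAntidiagonal (fun i j => f i * gi j),
      ← Finset.sum_erase_add _ _ h1mem, hf_apply 1, if_pos le_rfl, zero_mul, add_zero]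
    refine (Finset.abs_sum_le_sum_abs _ _).trans (Finset.sum_le_sum fun δ hδ => ?_)
    obtain ⟨hδ1, hδ⟩ := Finset.mem_erase.mp hδ
    have hδ0 : δ ≠ 0 := Nat.pos_iff_ne_zero.mp (Nat.pos_of_mem_divisors hδ)
    have hδ2 : ¬ δ ≤ 1 := by omega
    rw [hf_apply, if_neg hδ2, hgi_apply, abs_div, Nat.abs_cast, div_eq_mul_inv]
  -- sum over rough `d`, then swap
  have hstep1 : ∑ d ∈ (Finset.Ioc 0 N).filter (fun d : ℕ => d.Coprime P), |A.density d - (d : ℝ)⁻¹| ≤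
      ∑ d ∈ Finset.Ioc 0 N, (f * gi) d * a d := by
    rw [Finset.sum_filter]
    refine Finset.sum_le_sum fun d hd => ?_
    have hd0 : d ≠ 0 := Nat.pos_iff_ne_zero.mp (Finset.mem_Ioc.mp hd).1
    rw [ha]
    dsimp only
    split_ifs with hc
    · rw [mul_one]; exact hpt d hd0
    · rw [mul_zero]
  rw [sum_Ioc_mul_apply_mul_eq_sum_sum] at hstep1
  -- bound the inner sums by `R`, and kill the non-rough `δ`
  have hinner : ∀ δ ∈ Finset.Ioc 0 N, f δ * ∑ m ∈ Finset.Ioc 0 (N / δ), gi m * a (δ * m) ≤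
      (if δ.Coprime P ∧ δ ≠ 1 then |b δ| else 0) * R := by
    intro δ hδ
    have hδ0 : 0 < δ := (Finset.mem_Ioc.mp hδ).1
    have hin0 : 0 ≤ ∑ m ∈ Finset.Ioc 0 (N / δ), gi m * a (δ * m) :=
      Finset.sum_nonneg fun m _ => mul_nonneg (by rw [hgi_apply]; positivity) (ha0 _)
    have hinR : ∑ m ∈ Finset.Ioc 0 (N / δ), gi m * a (δ * m) ≤ R := by
      have hsub : ∑ m ∈ Finset.Ioc 0 (N / δ), gi m * a (δ * m) ≤
          ∑ m ∈ Finset.Ioc 0 N, gi m * a (δ * m) :=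
        Finset.sum_le_sum_of_subset_of_nonneg
          (Finset.Ioc_subset_Ioc le_rfl (Nat.div_le_self N δ))
          fun m _ _ => mul_nonneg (by rw [hgi_apply]; positivity) (ha0 _)
      refine hsub.trans ?_
      rw [hR, Finset.sum_filter]
      refine Finset.sum_le_sum fun m hm => ?_
      rw [hgi_apply, ha]
      dsimp only
      split_ifs with h1 h2 h2
      · rw [mul_one]
      · exact absurd (Nat.Coprime.coprime_mul_left h1) h2
      · rw [mul_zero]; positivity
      · rw [mul_zero]
    by_cases hc : δ.Coprime P ∧ δ ≠ 1
    · rw [if_pos hc, hf_apply, if_neg (by omega)]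
      exact mul_le_mul_of_nonneg_left hinR (abs_nonneg _)
    · rw [if_neg hc, zero_mul]
      rw [not_and_or, not_ne_iff] at hc
      rcases hc with hc | rfl
      · -- `δ` not rough: every `a (δ m)` vanishes
        have : ∑ m ∈ Finset.Ioc 0 (N / δ), gi m * a (δ * m) = 0 := by
          refine Finset.sum_eq_zero fun m _ => ?_
          rw [ha]
          dsimp only
          rw [if_neg (fun h => hc (Nat.Coprime.coprime_mul_right h)), mul_zero]
        rw [this, mul_zero]
      · rw [hf_apply, if_pos le_rfl, zero_mul]
  calc ∑ d ∈ (Finset.Ioc 0 N).filter (fun d : ℕ => d.Coprime P), |A.density d - (d : ℝ)⁻¹|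
      ≤ ∑ δ ∈ Finset.Ioc 0 N, f δ * ∑ m ∈ Finset.Ioc 0 (N / δ), gi m * a (δ * m) := hstep1
    _ ≤ ∑ δ ∈ Finset.Ioc 0 N, (if δ.Coprime P ∧ δ ≠ 1 then |b δ| else 0) * R :=
        Finset.sum_le_sum hinner
    _ = (∑ δ ∈ (Finset.Ioc 0 N).filter (fun δ : ℕ => δ.Coprime P ∧ δ ≠ 1), |b δ|) * R := by
        rw [← Finset.sum_mul, Finset.sum_filter]

/-- **[FriedlanderIwaniecPisa1978] Lemma 9 for `K = ℚ`, `N = 1`** (p. 737: "Denote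
`S_d = f(d)⁻¹ ∏_{p ∣ P(z)} (1 − 1/f(p)) − H′ (b₂(d)/d) ∏_{p ∣ P(z)} (1 − 1/p)^{b(p)}`. For
`2 + (log N)² ≤ z ≤ x`, we have `∑_{d ≤ x, (d, P(z)) = 1} |S_d| ≪ z^{−η} log x / log z`"; here
`b₂ = b(p) = 1`, `N = 1`, `H′ = H`), given Lemma 7 for
`A` (`FI1978_lemma7_rat`): split `S_d = g(d)(V(z) − H P(z)) + H P(z)(g(d) − 1/d)`, use Lemma 7 and Lemma 8 for the first
part, and `sum_rough_abs_density_sub_inv_le`, Lemma 6 (`∑_{δ ≥ z} |b(δ)| ≤ z^{−η} ∑|b(δ)|δ^η`)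
and `∑_{rough m ≤ x} 1/m ≤ e⁵ log x/log z` for the second. [cite: FriedlanderIwaniecPisa1978, Lemma 9 (K = Q, N = 1)] -/
theorem FI1978_lemma9_rat (A : SieveSequence) (H : ℝ) (hA : A.IsBombieriSequence)
    (hH : A.HasDensityConstant H) :
    ∃ η : ℝ, 0 < η ∧ ∃ C : ℝ, ∀ x z : ℝ, 2 ≤ z → z ≤ x →
      ∑ d ∈ (Finset.Ioc 0 ⌊x⌋₊).filter (fun d : ℕ => d.Coprime (primesProdBelow z)),
        |A.density d * A.densityProduct (primesProdBelow z) -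
          H * (∏ p ∈ Nat.primesBelow ⌈z⌉₊, (1 - (p : ℝ)⁻¹)) / d| ≤
        C * z ^ (-η) * Real.log x / Real.log z := by
  have h1 : A.BombieriA1 := hA.2.1
  have h5 : A.BombieriA5 := hA.2.2.2.2.2
  obtain ⟨H₇, hH₇0, hH₇, η₇, hη₇, C₇, hC₇⟩ := FI1978_lemma7_rat A hA
  have hHH : H = H₇ := tendsto_nhds_unique hH hH₇
  subst hHH
  obtain ⟨η₆, hη₆, b, hb1, hgb, hbs⟩ := FI1978_lemma6_rat A h1 h5
  obtain ⟨C₈, hC₈⟩ := FI1978_lemma8_rat A h1 h5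
  set B := ∑' n, |b n| * (n : ℝ) ^ η₆ with hB
  have hB0 : 0 ≤ B := tsum_nonneg fun n => by positivity
  set η := min η₆ η₇ with hη
  have hη0 : 0 < η := lt_min hη₆ hη₇
  refine ⟨η, hη0, 2 * max C₇ 0 * max C₈ 0 * H + 2 * Real.exp 5 * B * H, fun x z hz hzx => ?_⟩
  have hz1 : 1 < z := by linarith
  have hz0 : 0 < z := by linarith
  have hlogz : 0 < Real.log z := Real.log_pos hz1
  have hlogx : 0 < Real.log x := Real.log_pos (by linarith)
  set L := Real.log x / Real.log z with hL
  have hL0 : 0 < L := div_pos hlogx hlogz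
  set N := ⌊x⌋₊ with hN
  set V := A.densityProduct (primesProdBelow z) with hV
  set Pz := ∏ p ∈ Nat.primesBelow ⌈z⌉₊, (1 - (p : ℝ)⁻¹) with hPz
  have hPpos : 0 < Pz := Finset.prod_pos fun p hp =>
    sub_pos.mpr (inv_lt_one_of_one_lt₀ (by exact_mod_cast (Nat.prime_of_mem_primesBelow hp).one_lt))
  have hP2 : Pz ≤ 2 := by
    have h := prod_primesBelow_one_sub_inv_le hz1
    rw [← hPz] at h
    have hlog2 : Real.log 2 ≤ Real.log z := Real.log_le_log two_pos hz
    have := Real.log_two_gt_d9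
    calc Pz ≤ 1 / Real.log z := h
      _ ≤ 1 / Real.log 2 := one_div_le_one_div_of_le (by linarith) hlog2
      _ ≤ 2 := by rw [div_le_iff₀ (by linarith)]; linarith
  -- powers of `z`
  have hzη7 : z ^ (-η₇) ≤ z ^ (-η) :=
    Real.rpow_le_rpow_of_exponent_le hz1.le (by simp [hη])
  have hzη6 : z ^ (-η₆) ≤ z ^ (-η) :=
    Real.rpow_le_rpow_of_exponent_le hz1.le (by simp [hη])
  have hzη0 : 0 ≤ z ^ (-η) := Real.rpow_nonneg hz0.le _
  -- Lemma 7 and Lemma 8 at this `x, z`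
  obtain ⟨hVP, -⟩ := hC₇ z hz
  rw [← hV, ← hPz] at hVP
  have h8 := hC₈ x z hz hzx
  set D := (Finset.Ioc 0 N).filter (fun d : ℕ => d.Coprime (primesProdBelow z)) with hD
  have hsum8_0 : 0 ≤ ∑ d ∈ D, |A.density d| := Finset.sum_nonneg fun d _ => abs_nonneg _
  -- first part: `|V − H P| ∑ |g d| ≤ (C₇⁺ z^{−η} H · 2) (C₈⁺ L)`
  have hpart1 : |V - H * Pz| * ∑ d ∈ D, |A.density d| ≤
      (max C₇ 0 * z ^ (-η) * (H * 2)) * (max C₈ 0 * L) := by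
    refine mul_le_mul ?_ ?_ hsum8_0 (by positivity)
    · calc |V - H * Pz| ≤ C₇ * z ^ (-η₇) * (H * Pz) := hVP
        _ ≤ max C₇ 0 * z ^ (-η₇) * (H * Pz) := by gcongr; exact le_max_left _ _
        _ ≤ max C₇ 0 * z ^ (-η) * (H * 2) := by gcongr
    · calc ∑ d ∈ D, |A.density d| ≤ C₈ * Real.log x / Real.log z := h8
        _ = C₈ * L := by rw [hL]; ring
        _ ≤ max C₈ 0 * L := by gcongr; exact le_max_left _ _
  -- second part: `H P ∑ |g d − 1/d| ≤ H · 2 · (z^{−η} B) (e⁵ L)`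
  have hswap := sum_rough_abs_density_sub_inv_le A hb1 hgb x z
  rw [← hN, ← hD] at hswap
  have hbtail : ∑ δ ∈ (Finset.Ioc 0 N).filter
      (fun δ : ℕ => δ.Coprime (primesProdBelow z) ∧ δ ≠ 1), |b δ| ≤ z ^ (-η) * B := by
    have hM : 1 ≤ ⌈z⌉₊ := Nat.one_le_iff_ne_zero.mpr (Nat.ceil_pos.mpr hz0).ne'
    have hS : ∀ n ∈ (Finset.Ioc 0 N).filter
        (fun δ : ℕ => δ.Coprime (primesProdBelow z) ∧ δ ≠ 1), ⌈z⌉₊ ≤ n := by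
      intro n hn
      obtain ⟨hn, hcop, hn1⟩ := Finset.mem_filter.mp hn
      have hn0 : n ≠ 0 := Nat.pos_iff_ne_zero.mp (Finset.mem_Ioc.mp hn).1
      exact Nat.ceil_le.mpr (le_of_rough hn0 hn1 hcop)
    refine (sum_abs_le_of_le_mem hη₆.le hbs hM hS).trans ?_
    refine mul_le_mul_of_nonneg_right ?_ hB0
    exact (Real.rpow_le_rpow_of_nonpos hz0 (Nat.le_ceil z) (by linarith)).trans hzη6
  have hR := sum_inv_rough_le hz hzx
  rw [← hN] at hR
  have hR0 : 0 ≤ ∑ m ∈ (Finset.Ioc 0 N).filter (fun m : ℕ => m.Coprime (primesProdBelow z)),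
      (m : ℝ)⁻¹ := Finset.sum_nonneg fun m _ => inv_nonneg.mpr (Nat.cast_nonneg _)
  have hpart2 : H * Pz * ∑ d ∈ D, |A.density d - (d : ℝ)⁻¹| ≤
      H * 2 * ((z ^ (-η) * B) * (Real.exp 5 * L)) := by
    refine mul_le_mul (by gcongr) (hswap.trans ?_) (Finset.sum_nonneg fun d _ => abs_nonneg _)
      (by positivity)
    refine mul_le_mul hbtail ?_ hR0 (by positivity)
    rw [hL, ← mul_div_assoc]
    exact hR
  -- termwise splitting
  have hterm : ∀ d ∈ D, |A.density d * V - H * Pz / d| ≤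
      |V - H * Pz| * |A.density d| + H * Pz * |A.density d - (d : ℝ)⁻¹| := by
    intro d _
    have e : A.density d * V - H * Pz / d =
        (V - H * Pz) * A.density d + (H * Pz) * (A.density d - (d : ℝ)⁻¹) := by ring
    rw [e]
    refine (abs_add_le _ _).trans (le_of_eq ?_)
    rw [abs_mul, abs_mul, abs_of_pos (mul_pos hH₇0 hPpos)]
  calc ∑ d ∈ D, |A.density d * V - H * Pz / d|
      ≤ ∑ d ∈ D, (|V - H * Pz| * |A.density d| + H * Pz * |A.density d - (d : ℝ)⁻¹|) :=
        Finset.sum_le_sum hterm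
    _ = |V - H * Pz| * ∑ d ∈ D, |A.density d| + H * Pz * ∑ d ∈ D, |A.density d - (d : ℝ)⁻¹| := by
        rw [Finset.sum_add_distrib, Finset.mul_sum, Finset.mul_sum]
    _ ≤ (max C₇ 0 * z ^ (-η) * (H * 2)) * (max C₈ 0 * L) +
          H * 2 * ((z ^ (-η) * B) * (Real.exp 5 * L)) := add_le_add hpart1 hpart2
    _ = (2 * max C₇ 0 * max C₈ 0 * H + 2 * Real.exp 5 * B * H) * z ^ (-η) * Real.log x /
          Real.log z := by
        rw [hL]; ring

end BombieriSieve

end Literature.NumberTheory.Sieve
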